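import Mathlib.Algebra.BigOperators.Field
import Summits.QuantumFields.BalabanUV.Beta.GAN24.DirichletRingHessianWindow
import Summits.QuantumFields.BalabanUV.Beta.GAN24.DirichletRingWeighted

/-!
# `BalabanUV.Beta.GAN24.DirichletRingSiteWeighted` — binder row G-an2-4 / (CONV-C), road P2 PART IV, leaf L14 (the torus transfer),
# model brick: THE SITE-INDEXED INVERSE-WEIGHTED ENERGY `Σ_{Q_K} nbr/ρ` IS AT MOST TWICE THE RING-INDEXED ONE (unit b2b-balaban-gan24-p2, gen 26, v1)

HONEST FRAMING (cell contract, verbatim): «discharging `BetaPertH` makes Bałaban's UV stability UNCONDITIONAL — a real constructive-QFT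
result; it is NOT the continuum limit and NOT the Clay problem.»  SUPPLIER brick under the T⁴-DAG sub-row `T4-U1a.S-NE2-D1-DIRICHLET°`
(holder: the t4-ne2-p1 lineage; owner wording R24 «the full rate L⁻¹ beyond boxes OPEN»), MODEL coordinates (the plane lattice `ℤ²` around
one re-entrant vertex, lattice units).  Binder (B) at a vertex was landed ring by ring (`DirichletRingWeighted.weighted_ring_energy_le`:
`Σ_{k ≤ n} (Tan_k + Rad_k)/k ≤ …`).  The torus transfer (leaf L14) pushes a SITE weight `n/ρ(x)` forward along the chart (`ρ = max(tIdx i, tIdx j)`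
the ring index of `DirichletRingHessianWindow.rho`), so it meets the site-indexed sum `Σ_{x ∈ Q_K} nbr U (x)/ρ(x)` (`nbr` = the four squared
neighbour differences at `x`, `DirichletRingHessianWindow.nbr`).  This file bounds it by the ring-indexed one:

* §1 `rho` on the ring `Q_{k+1} ∖ Q_k` equals `k + 1` (the four sides), hence **`sqSum_div_rho_succ`**:
  `sqSum (nbr/ρ) (k+1) = sqSum (nbr/ρ) k + (sqSum nbr (k+1) − sqSum nbr k)/(k+1)` and `sqSum_div_rho_eq`: `= Σ_{k=1}^{K} (N_k − N_{k−1})/k`, `N_k := sqSum nbr k`.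
* §2 **`site_weighted_le_ring_weighted`**: `Σ_{Q_K} nbr/ρ ≤ 2·Σ_{k=1}^{K} (Tan_k + Rad_k)/k` — Abel summation `DirichletRingWeighted.abel_inv` forward
  on `N_k`, `N_k ≤ 2Ẽ_k` (`DirichletRingHessianWindow.nbr_sqSum_le`), Abel summation backward on `Ẽ_k`, `Ẽ_k − Ẽ_{k−1} = Tan_k + Rad_k`.
* §3 **`site_weighted_energy_le`** = §2 + `weighted_ring_energy_le` BY NAME: under `hU`, `hEq`, `0 < ε`, `1 < γ = π/3·(1−ε/2)`, `1 ≤ n`: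
  `Σ_{Q_n} nbr U/ρ ≤ 2·(Ẽ_n + (16/(γ−1))·M_n)/n`, `M_n = Ẽ_n + (π/(2ε))·SG_n·(n+3)²/(2−γ)`.

ABSOLUTE RULE (cell, verbatim): «No internally-minted statement may enter as a cited fact. Every hypothesis is either kernel-proved in
this package or a verbatim quotation of a PUBLISHED theorem with page reference. The manuscript(s) under audit are NOT citable for
their own disputed steps — they are the thing under adjudication; programme-internal (2001/route/tribunal) claims are never citable.»
[folklore] finite sums; nothing printed is a hypothesis.  NOT CLAIMED: (B) on the torus (next file), NE2, (CONV-C), `BetaPertH`, continuum,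
Clay.  «not in print; our proof attempt».  HONEST DEPENDENCY: continuum YM on T⁴ ⇐ BetaPertH ∧ nine spine estimates (0/9 proved); BetaPertH ⇐
(D1) ∧ (D4) ∧ CAP+tail; G-an2-4 gates asym, D1 and NE2/3/4.
-/

noncomputable section

open scoped BigOperators
open Finset

namespace Summit.QuantumFields.BalabanUV.Beta.GAN24.DirichletRingSiteWeighted

open DirichletRingEnergies (lap Tan Rad Et sqSum sqSum_succ Et_succ_sub Et_zero Et_nonneg sqSum_nonneg)
open DirichletRingCutoff (tIdx)
open DirichletRingHessianWindow (rho nbr nbr_sqSum_le)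
open DirichletRingWeighted (abel_inv weighted_ring_energy_le)

variable (U : ℤ → ℤ → ℂ)

/-! ## §1 The ring index on a ring; peeling the site-weighted sum -/

/-- on the bottom and top rows of the ring `Q_{k+1} ∖ Q_k` the ring index is `k + 1`. [folklore] -/
theorem rho_row (k : ℕ) {s : ℕ} (hs : s < 2 * k + 2) :
    rho (-((k + 1 : ℕ) : ℤ) + s) (-((k + 1 : ℕ) : ℤ)) = (k : ℤ) + 1 ∧ rho (-((k + 1 : ℕ) : ℤ) + s) ((k : ℕ) : ℤ) = (k : ℤ) + 1 := by
  unfold rho tIdx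
  constructor <;> (split_ifs <;> push_cast <;> omega)

/-- on the left and right columns of the ring the ring index is `k + 1`. [folklore] -/
theorem rho_col (k : ℕ) {t : ℕ} (ht : t < 2 * k) :
    rho (-((k + 1 : ℕ) : ℤ)) (-(k : ℤ) + t) = (k : ℤ) + 1 ∧ rho ((k : ℕ) : ℤ) (-(k : ℤ) + t) = (k : ℤ) + 1 := by
  unfold rho tIdx
  constructor <;> (split_ifs <;> push_cast <;> omega)

/-- `0 ≤ nbr`. [folklore] -/
theorem nbr_nonneg (i j : ℤ) : 0 ≤ nbr U i j := by unfold nbr; positivity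

/-- **peeling one ring of the site-weighted sum**: `sqSum (nbr/ρ) (k+1) = sqSum (nbr/ρ) k + (sqSum nbr (k+1) − sqSum nbr k)/(k+1)`. [folklore] -/
theorem sqSum_div_rho_succ (k : ℕ) :
    sqSum (fun i j => nbr U i j / (rho i j : ℝ)) (k + 1)
      = sqSum (fun i j => nbr U i j / (rho i j : ℝ)) k + (sqSum (nbr U) (k + 1) - sqSum (nbr U) k) / ((k : ℝ) + 1) := by
  rw [sqSum_succ, sqSum_succ (nbr U) k, add_sub_cancel_left, add_div, add_div, Finset.sum_div, Finset.sum_div, Finset.sum_div]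
  congr 1; congr 1; congr 1
  · refine sum_congr rfl fun s hs => ?_
    rw [(rho_row k (mem_range.mp hs)).1]; push_cast; ring
  · refine sum_congr rfl fun s hs => ?_
    rw [(rho_row k (mem_range.mp hs)).2]; push_cast; ring
  · refine sum_congr rfl fun t ht => ?_
    rw [(rho_col k (mem_range.mp ht)).1, (rho_col k (mem_range.mp ht)).2, add_div]; push_cast; ring

/-- **the site-weighted sum as an Abel sum**: `sqSum (nbr/ρ) K = Σ_{k=1}^{K} (N_k − N_{k−1})/k`, `N_k = sqSum nbr k`. [folklore] -/
theorem sqSum_div_rho_eq (K : ℕ) :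
    sqSum (fun i j => nbr U i j / (rho i j : ℝ)) K = ∑ k ∈ Icc 1 K, (sqSum (nbr U) k - sqSum (nbr U) (k - 1)) / k := by
  induction K with
  | zero => simp [sqSum]
  | succ K ih =>
      rw [sqSum_div_rho_succ, ih, sum_Icc_succ_top (by omega), Nat.add_sub_cancel]
      push_cast
      ring

/-! ## §2 Site-weighted ≤ 2 × ring-weighted -/

/-- **THE SITE-INDEXED INVERSE-WEIGHTED ENERGY IS AT MOST TWICE THE RING-INDEXED ONE**: for `1 ≤ K`,
`Σ_{Q_K} nbr U/ρ ≤ 2·Σ_{k=1}^{K} (Tan U k + Rad U k)/k`. [folklore] -/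
theorem site_weighted_le_ring_weighted {K : ℕ} (hK : 1 ≤ K) :
    sqSum (fun i j => nbr U i j / (rho i j : ℝ)) K ≤ 2 * ∑ k ∈ Icc 1 K, (Tan U k + Rad U k) / k := by
  -- the ring-weighted sum as an Abel sum of `Ẽ`
  have hinc : ∀ k ∈ Icc 1 K, (Tan U k + Rad U k) / k = (Et U k - Et U (k - 1)) / k := by
    intro k hk
    obtain ⟨hk1, -⟩ := mem_Icc.mp hk
    obtain ⟨j, rfl⟩ : ∃ j, k = j + 1 := ⟨k - 1, by omega⟩
    rw [Nat.add_sub_cancel, Et_succ_sub]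
  rw [sum_congr rfl hinc, sqSum_div_rho_eq, abel_inv (fun k => sqSum (nbr U) k) hK, abel_inv (fun k => Et U k) hK, Et_zero, sub_zero]
  have hN0 : sqSum (nbr U) 0 = 0 := by simp [sqSum]
  rw [hN0, sub_zero, mul_add, mul_sum]
  have hK0 : (0 : ℝ) < K := by exact_mod_cast hK
  refine add_le_add ?_ (sum_le_sum fun k hk => ?_)
  · rw [← mul_div_assoc]
    exact div_le_div_of_nonneg_right (nbr_sqSum_le U hK) hK0.le
  · obtain ⟨hk1, -⟩ := mem_Ico.mp hk
    have hk0 : (0 : ℝ) < k := by exact_mod_cast hk1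
    have hw0 : 0 ≤ 1 / (k : ℝ) - 1 / ((k : ℝ) + 1) := by
      rw [div_sub_div _ _ hk0.ne' (by positivity), le_div_iff₀ (by positivity)]; linarith
    rw [← mul_assoc]
    exact mul_le_mul_of_nonneg_right (nbr_sqSum_le U hk1) hw0

/-! ## §3 With the decay: the site-weighted energy at a re-entrant vertex -/

/-- **THE SITE-WEIGHTED ENERGY AT A RE-ENTRANT VERTEX (model)**: under `hU`, `hEq`, `0 < ε`, `1 < γ = π/3·(1−ε/2)` and `1 ≤ n`,
`Σ_{Q_n} nbr U/ρ ≤ 2·(Ẽ_n + (16/(γ−1))·(Ẽ_n + (π/(2ε))·SG_n·(n+3)²/(2−γ)))/n`. [folklore] -/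
theorem site_weighted_energy_le {n : ℕ} (hn : 1 ≤ n) (G : ℤ → ℤ → ℂ)
    (hU : ∀ s t : ℤ, 0 ≤ s → 0 ≤ t → U s t = 0)
    (hEq : ∀ i j : ℤ, -(n : ℤ) ≤ i → i < n → -(n : ℤ) ≤ j → j < n → ¬(0 ≤ i ∧ 0 ≤ j) → lap U i j = G i j)
    {ε : ℝ} (hε : 0 < ε) (hγ : 1 < Real.pi / 3 * (1 - ε / 2)) :
    sqSum (fun i j => nbr U i j / (rho i j : ℝ)) n
      ≤ 2 * ((Et U n + 16 / (Real.pi / 3 * (1 - ε / 2) - 1)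
          * (Et U n + (Real.pi / (2 * ε) * sqSum (fun i j => ‖G i j‖ ^ 2) n) * ((n : ℝ) + 3) ^ 2
              / (2 - Real.pi / 3 * (1 - ε / 2)))) / n) :=
  (site_weighted_le_ring_weighted U hn).trans
    (mul_le_mul_of_nonneg_left (weighted_ring_energy_le U hn G hU hEq hε hγ) zero_le_two)

end Summit.QuantumFields.BalabanUV.Beta.GAN24.DirichletRingSiteWeighted

end
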